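import Mathlib
import Literature.AlgebraicGeometry.Resolution.OrderFlatLocalHom
import Literature.AlgebraicGeometry.Resolution.SmoothImpliesRegular

/-!
# Essentially smooth local homomorphisms reflect the `𝔪`-adic filtration

LIBRARY (def-free).  For a LOCAL homomorphism `S → S'` of Noetherian local rings which is FORMALLY SMOOTH and
ESSENTIALLY OF FINITE TYPE, and every `n`:
`a ∈ 𝔪_S ^ n ↔ algebraMap S S' a ∈ 𝔪_{S'} ^ n` (`mem_pow_maximalIdeal_iff_of_formallySmooth_essFiniteType`).

Ingredients: (1) `Module.Flat S S'` — `S'` is a quotient of a localisation of a polynomial ring over `S`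
(Mathlib `Algebra.EssFiniteType`), and Mathlib's `Algebra.FormallySmooth.flat_of_algHom_of_isNoetherianRing`;
(2) the closed fibre `S' ⧸ 𝔪_S S'` is a REGULAR local ring — it is formally smooth and essentially of finite type over
the residue field `κ = S ⧸ 𝔪_S` (base change), hence the localisation of a finite-type `κ`-algebra at a prime that is
smooth there, and the tree's `isRegularLocalRing_of_isSmoothAt` (SmoothImpliesRegular) applies;
(3) the tree's `mem_pow_maximalIdeal_iff_of_isRegularLocalRing_fiber` (OrderFlatLocalHom: flat local homomorphism with
regular closed fibre preserves and reflects `𝔪ⁿ`).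

Use (W4.3 door, crux `HypersurfaceCentreConstruction` stmt-ResolutionOfSingularities-19897): the clause (c11)
`IotaJEssSmoothCompatible` of `LocalWeightedDropEFT3/4S` quantifies over exactly these maps; the lemma is what the seam
`eft3_of_eft4S` (res-L1-w43-plan-1 ORDER (o22); res-type-070 FINDING 06:36Z / res-type-061 06:37Z) needs to transport
«`f ∉ 𝔪_S²`» along them.  [OURS · library · res-type-070; AI work, weaker than expert review.]
-/

set_option linter.dupNamespace false

noncomputable section

open IsLocalRing

namespace Summit.ResolutionOfSingularities.ResolutionOfSingularities.Cruxes.HypersurfaceCentreConstruction.LocalEngine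

universe u v

/-! ## §1. Finite-type models of essentially-of-finite-type algebras (any base ring, any universe) -/

section Model

variable {R : Type u} [CommRing R] {S : Type v} [CommRing S] [Algebra R S]

/-- **Any element lies in a finite-type model**: if `S` is essentially of finite type over `R`, then for every `f ∈ S`
there is a finite set `σ ∋ f` such that `S` is the localisation of `R[σ] ⊆ S` at the elements invertible in `S`
(Mathlib's defining property of `Algebra.EssFiniteType`, generating set enlarged by `f`).  Universe-polymorphic, any base
ring (the field / `Type 0` version is `exists_finiteType_model`, p505133). -/
theorem exists_adjoin_model_of_essFiniteType [Algebra.EssFiniteType R S] (f : S) :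
    ∃ σ : Finset S, f ∈ Algebra.adjoin R (σ : Set S) ∧
      IsLocalization ((IsUnit.submonoid S).comap (algebraMap (Algebra.adjoin R (σ : Set S)) S)) S := by
  classical
  obtain ⟨σ, hσ⟩ := (Algebra.essFiniteType_iff R S).mp inferInstance
  refine ⟨insert f σ, Algebra.subset_adjoin (by simp), ?_⟩
  rw [Algebra.essFiniteType_cond_iff]
  intro s
  obtain ⟨t, ht, htu, hst⟩ := hσ s
  have hle : Algebra.adjoin R (σ : Set S) ≤ Algebra.adjoin R ((insert f σ : Finset S) : Set S) :=
    Algebra.adjoin_mono (by simp [Set.subset_insert])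
  exact ⟨t, hle ht, htu, hle hst⟩

/-- For a LOCAL `S` and a subalgebra `A ⊆ S`, the elements of `A` invertible in `S` form the complement of the prime
`𝔪_S ∩ A`. -/
theorem primeCompl_comap_maximalIdeal_eq [IsLocalRing S] (A : Subalgebra R S) :
    ((maximalIdeal S).comap (algebraMap A S)).primeCompl = (IsUnit.submonoid S).comap (algebraMap A S) := by
  ext x
  rw [Ideal.mem_primeCompl_iff, Ideal.mem_comap, Submonoid.mem_comap, IsUnit.mem_submonoid_iff]
  exact IsLocalRing.notMem_maximalIdeal (R := S)

end Model

/-! ## §2. Flatness of formally smooth, essentially-of-finite-type algebras over a Noetherian ring -/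

section Flat

variable (S : Type u) (S' : Type v) [CommRing S] [CommRing S'] [Algebra S S']

/-- **A formally smooth algebra essentially of finite type over a Noetherian ring is flat.**  `S'` is the localisation of
a finite-type subalgebra `B₀ = S[σ]` at a submonoid, hence a quotient of the localisation `P` of a polynomial ring
`S[X₁,…,Xₙ]` at a submonoid; `P` is flat and Noetherian over `S`, so Mathlib's
`Algebra.FormallySmooth.flat_of_algHom_of_isNoetherianRing` applies. -/
theorem flat_of_formallySmooth_of_essFiniteType [IsNoetherianRing S] [Algebra.FormallySmooth S S']
    [Algebra.EssFiniteType S S'] : Module.Flat S S' := by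
  classical
  let B₀ : Subalgebra S S' := Algebra.EssFiniteType.subalgebra S S'
  let M : Submonoid B₀ := Algebra.EssFiniteType.submonoid S S'
  haveI : IsLocalization M S' := Algebra.EssFiniteType.isLocalization S S'
  obtain ⟨n, φ, hφ⟩ :=
    Algebra.FiniteType.iff_quotient_mvPolynomial''.mp (inferInstance : Algebra.FiniteType S B₀)
  let N : Submonoid (MvPolynomial (Fin n) S) := M.comap φ
  let P := Localization N
  let g : MvPolynomial (Fin n) S →+* S' := (algebraMap B₀ S').comp φ.toRingHom
  have hg : ∀ y : N, IsUnit (g y) := fun y => IsLocalization.map_units S' (⟨φ y.1, y.2⟩ : M)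
  let ψ₀ : P →+* S' := IsLocalization.lift (M := N) hg
  have hψ₀C : ∀ s : S, ψ₀ (algebraMap S P s) = algebraMap S S' s := by
    intro s
    rw [IsScalarTower.algebraMap_apply S (MvPolynomial (Fin n) S) P, IsLocalization.lift_eq]
    change algebraMap B₀ S' (φ (algebraMap S (MvPolynomial (Fin n) S) s)) = _
    rw [φ.commutes, ← IsScalarTower.algebraMap_apply]
  let ψ : P →ₐ[S] S' := { ψ₀ with commutes' := hψ₀C }
  have hψ : Function.Surjective ψ := by
    intro z
    obtain ⟨⟨b, m⟩, hz⟩ := IsLocalization.surj M z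
    obtain ⟨x, hx⟩ := hφ b
    obtain ⟨y, hy⟩ := hφ m.1
    have hyN : y ∈ N := by
      change φ y ∈ M
      rw [hy]
      exact m.2
    refine ⟨IsLocalization.mk' P x ⟨y, hyN⟩, ?_⟩
    change ψ₀ (IsLocalization.mk' P x ⟨y, hyN⟩) = z
    rw [IsLocalization.lift_mk']
    -- `g x = algebraMap b`, `g y = algebraMap m`
    have hgx : g x = algebraMap B₀ S' b := by change algebraMap B₀ S' (φ x) = _; rw [hx]
    have hgy : g y = algebraMap B₀ S' m := by change algebraMap B₀ S' (φ y) = _; rw [hy]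
    rw [Units.mul_inv_eq_iff_eq_mul, hgx, IsUnit.coe_liftRight]
    change algebraMap B₀ S' b = z * g y
    rw [hgy, hz]
  haveI : Module.Flat (MvPolynomial (Fin n) S) P := IsLocalization.flat P N
  haveI : Module.Flat S P := Module.Flat.trans S (MvPolynomial (Fin n) S) P
  exact Algebra.FormallySmooth.flat_of_algHom_of_isNoetherianRing ψ hψ

end Flat

/-! ## §3. The closed fibre of a formally smooth e.f.t. local homomorphism is a regular local ring -/

section Fibre

variable (S S' : Type) [CommRing S] [CommRing S'] [Algebra S S'] [IsLocalRing S] [IsLocalRing S']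
  [IsLocalHom (algebraMap S S')]

/-- [folklore] The closed fibre `S' ⧸ 𝔪_S S'` of a local homomorphism is a local ring. -/
theorem isLocalRing_fiber : IsLocalRing (S' ⧸ (maximalIdeal S).map (algebraMap S S')) := by
  haveI : Nontrivial (S' ⧸ (maximalIdeal S).map (algebraMap S S')) :=
    Ideal.Quotient.nontrivial_iff.mpr (IsLocalRing.map_maximalIdeal_lt_top (algebraMap S S')).ne
  exact IsLocalRing.of_surjective' (Ideal.Quotient.mk _) Ideal.Quotient.mk_surjective

/-- **The closed fibre of a formally smooth local homomorphism essentially of finite type is a REGULAR local ring.**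
The fibre `Φ = S' ⧸ 𝔪_S S' ≅ κ ⊗_S S'` is formally smooth and essentially of finite type over the residue field
`κ = S ⧸ 𝔪_S`; it is the localisation `B_q` of a finite-type (hence finitely presented) `κ`-subalgebra `B` at the prime
`q = 𝔪_Φ ∩ B`, smooth at `q`, so the tree's `isRegularLocalRing_of_isSmoothAt` (Zariski–Jacobi / formal smoothness ⇒
regularity over a field) applies. -/
theorem isRegularLocalRing_fiber [Algebra.FormallySmooth S S'] [Algebra.EssFiniteType S S'] :
    IsRegularLocalRing (S' ⧸ (maximalIdeal S).map (algebraMap S S')) := by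
  classical
  let 𝔪 := maximalIdeal S
  let κ := S ⧸ 𝔪
  let Φ := S' ⧸ 𝔪.map (algebraMap S S')
  haveI : IsLocalRing Φ := isLocalRing_fiber S S'
  letI : Field κ := Ideal.Quotient.field 𝔪
  -- formal smoothness and essential finiteness of the fibre over the residue field
  haveI : Algebra.FormallySmooth κ Φ :=
    Algebra.FormallySmooth.of_equiv (Algebra.TensorProduct.quotIdealMapEquivQuotTensor S' 𝔪).symm
  haveI : Algebra.EssFiniteType κ Φ := inferInstance
  -- a finite-type model `B ⊆ Φ`, `Φ = B_q`
  obtain ⟨σ, -, hloc⟩ := exists_adjoin_model_of_essFiniteType (R := κ) (S := Φ) (0 : Φ)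
  let B : Subalgebra κ Φ := Algebra.adjoin κ (σ : Set Φ)
  haveI hBft : Algebra.FiniteType κ B := by
    constructor
    rw [Subalgebra.fg_top]
    exact ⟨σ, rfl⟩
  haveI : Algebra.FinitePresentation κ B := (Algebra.FinitePresentation.of_finiteType (R := κ) (A := B)).mp hBft
  let q : Ideal B := (maximalIdeal Φ).comap (algebraMap B Φ)
  haveI hq : q.IsPrime := Ideal.IsPrime.comap _
  haveI : IsLocalization q.primeCompl Φ := by
    rw [primeCompl_comap_maximalIdeal_eq]
    exact hloc
  let e : Localization.AtPrime q ≃ₐ[B] Φ := IsLocalization.algEquiv q.primeCompl (Localization.AtPrime q) Φ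
  haveI : Algebra.IsSmoothAt κ q := Algebra.FormallySmooth.of_equiv (e.restrictScalars κ).symm
  haveI : IsRegularLocalRing (Localization.AtPrime q) :=
    Literature.AlgebraicGeometry.Resolution.isRegularLocalRing_of_isSmoothAt κ B q
  exact IsRegularLocalRing.of_ringEquiv (R := Localization.AtPrime q) e.toRingEquiv

end Fibre

/-! ## §4. Reflection of the `𝔪`-adic filtration -/

section Reflect

variable {S S' : Type} [CommRing S] [CommRing S'] [Algebra S S'] [IsLocalRing S] [IsNoetherianRing S]
  [IsLocalRing S'] [IsNoetherianRing S'] [IsLocalHom (algebraMap S S')]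
  [Algebra.FormallySmooth S S'] [Algebra.EssFiniteType S S']

/-- **An essentially smooth local homomorphism preserves and reflects the powers of the maximal ideals**: for a local,
formally smooth, essentially-of-finite-type homomorphism `S → S'` of Noetherian local rings and every `n`,
`a ∈ 𝔪_S ^ n ↔ algebraMap S S' a ∈ 𝔪_{S'} ^ n` (flat with regular closed fibre: §2, §3 and the tree's
`mem_pow_maximalIdeal_iff_of_isRegularLocalRing_fiber`). -/
theorem mem_pow_maximalIdeal_iff_of_formallySmooth_essFiniteType (n : ℕ) (a : S) :
    a ∈ maximalIdeal S ^ n ↔ algebraMap S S' a ∈ maximalIdeal S' ^ n := by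
  haveI : Module.Flat S S' := flat_of_formallySmooth_of_essFiniteType S S'
  exact Literature.AlgebraicGeometry.Resolution.mem_pow_maximalIdeal_iff_of_isRegularLocalRing_fiber
    (isRegularLocalRing_fiber S S') n a

/-- The contrapositive form used by the door seam: `a ∉ 𝔪_S ^ n ⇒ algebraMap a ∉ 𝔪_{S'} ^ n`. -/
theorem not_mem_pow_maximalIdeal_map_of_formallySmooth_essFiniteType {n : ℕ} {a : S}
    (ha : a ∉ maximalIdeal S ^ n) : algebraMap S S' a ∉ maximalIdeal S' ^ n :=
  fun h => ha ((mem_pow_maximalIdeal_iff_of_formallySmooth_essFiniteType n a).mpr h)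

end Reflect

end Summit.ResolutionOfSingularities.ResolutionOfSingularities.Cruxes.HypersurfaceCentreConstruction.LocalEngine

end
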